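import Literature.NumberTheory.Automorphic.Paramodular.Paramodularity
import Literature.NumberTheory.DiophantineGeometry.AVGaloisModuleContinuityProofs
import Literature.NumberTheory.FaltingsSerre.ParamodularBridge
import Literature.NumberTheory.LFunctions.WeilConjecturesFatouProofs
import HarnessLib

/-!
# Venture ResidMod — bridge B3: what a good Euler factor `L_p(A,T)` says about the framed DUAL
# `p`-adic representations `r(g) = [g⁻¹]_bᵀ` (the `ρ_{A,ℓ}` on `H¹` of Boxer–Calegari–Gee–Pilloni)

HONEST FRAMING. Theorems only; no fact, no definition, no claim about any surface. This file closes the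
gap ("bridge B3" of the cell `pub-residmod`, PLAN R11) between the Euler-factor predicate the engines
certify — `A.HasGoodEulerFactorAt p L` ([BPPTVY (4.1.5)]: for every prime `ℓ ≠ p` and every matrix
form `r₀` of `V_ℓ(A)` in a basis `b`, `r₀` is unramified at `v ∣ p` with arithmetic-Frobenius
polynomial `X⁴L(1/X)`) — and the hypothesis shape of the tree's BCGP facts, which speak about the
framed DUAL `r(g) = [g⁻¹]_bᵀ ⊗ ℚ̄_ℓ` (`(V_ℓ A)^∨ ⊗ ℚ̄_ℓ = H¹_ét(A_ℚ̄, ℚ̄_ℓ)`, BCGP 2025 §1.8): e.g.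
hypothesis (3b) of `Literature.NumberTheory.DiophantineGeometry.bcgp2025_modThreeSurjective_modular_abelianSurface`
("the characteristic polynomial of Frobenius at `3` does not have repeated roots": every framed dual of
every `V_ℓ(A)`, `ℓ ≠ 3`, is unramified at `v ∣ 3` with separable Frobenius polynomials).

WHAT IS PROVED (pure bookkeeping: transpose, inverse, `Matrix.charpoly_inv`, `Polynomial.reverse`; the
involution `reverse (reverse L) = L` for `L(0) ≠ 0` is the tree's
`Literature.NumberTheory.LFunctions.WeilFatou.reverse_reverse_of_coeff_zero_ne_zero`):
* `dualFrame_of_hasGoodEulerFactorAt` — if `L = L_p(A,T)` (`HasGoodEulerFactorAt`, `L(0) ≠ 0`) then for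
  every `ℓ ≠ p`, basis `b`, framed dual `r` and `v ∣ p`: `r` is unramified at `v`, and every Frobenius
  polynomial of `r` at `v` equals `C (lc L)⁻¹ · L(X)` — the arithmetic Frobenius on the DUAL has the
  inverse eigenvalues, whose monic polynomial is `L(X)/lc(L)` (`lc L = p²` for a surface).
* `separable_dualFrame_of_hasGoodEulerFactorAt` — hence if `L` is separable over `ℚ`, those Frobenius
  polynomials are separable: exactly hypothesis (3b) above from `L₃(A,T)` and a separability
  certificate for `L₃` (a Bézout pair), the cell's slot DIST0(3) (PLAN R4/R7).

References: [BrumerEtAl2019] ANT 13 (2019) (4.1.5) p. 1164; [BoxerCalegariGeePilloni2025]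
arXiv:2502.20645 Thm. 1.1.1 (3), §1.8 (conventions: `ρ_{A,p}` on `H¹`); [SerreTate1968] §1.
-/

noncomputable section

namespace Summit.Ventures.ResidMod

open Polynomial Matrix Field IsDedekindDomain
open scoped NumberField
open Literature.NumberTheory.GaloisRepresentations Literature.NumberTheory.Automorphic.Paramodular
open Literature.NumberTheory.FaltingsSerre
open Literature.AlgebraicGeometry.Motives (AbelianVariety)

variable {A : AbelianVariety ℚ} {p : ℕ} {L : ℚ[X]}

/-- **The framed dual at a good prime.**  Let `L = L_p(A,T)` be the good Euler factor of the abelian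
surface `A` at `p` (`HasGoodEulerFactorAt`; `L(0) ≠ 0`), `ℓ ≠ p` a prime, `b` a `ℚ_ℓ`-basis of
`V_ℓ(A)` and `r : Γ_ℚ → GL₄(ℚ̄_ℓ)` the framed dual, `r(g) = [g⁻¹]_bᵀ`. Then at every `v ∣ p`: `r` is
unramified, and every Frobenius polynomial `Q` of `r` at `v` is `C (lc L)⁻¹ · L(X)` (read in `ℚ̄_ℓ`):
the direct frame `[·]_b` has Frobenius polynomial `X⁴L(1/X)` (definition of `HasGoodEulerFactorAt`),
and `det(X − M⁻¹) = det(M)⁻¹ · reverse det(X − M)` (`Matrix.charpoly_inv`).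
[cite: BrumerEtAl2019, (4.1.5) p. 1164] [cite: BoxerCalegariGeePilloni2025, §1.8 (ρ_{A,p} on H¹)] -/
theorem dualFrame_of_hasGoodEulerFactorAt (hL : A.HasGoodEulerFactorAt p L) (hL0 : L.coeff 0 ≠ 0)
    {ℓ : ℕ} [Fact ℓ.Prime] (hℓ : ℓ ≠ p) (b : Module.Basis (Fin 4) ℚ_[ℓ] (A.rationalTateModule ℓ))
    (r : FramedGaloisRep ℚ (PadicAlgCl ℓ) 4)
    (hr : ∀ g : absoluteGaloisGroup ℚ,
      (r g).val =
        ((LinearMap.toMatrix b b (A.rationalTateRep ℓ g⁻¹)).map (algebraMap ℚ_[ℓ] (PadicAlgCl ℓ))).transpose)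
    {v : HeightOneSpectrum (𝓞 ℚ)} (hv : ((p : ℕ) : 𝓞 ℚ) ∈ v.asIdeal) :
    r.IsUnramifiedAt v ∧
      ∀ Q : Polynomial (PadicAlgCl ℓ), r.HasFrobCharpolyAt v Q →
        Q = C ((algebraMap ℚ (PadicAlgCl ℓ) L.leadingCoeff)⁻¹) * L.map (algebraMap ℚ (PadicAlgCl ℓ)) := by
  -- the direct frame `r₀ = [·]_b` of `V_ℓ(A)` (continuity: the tree's theorem)
  have hℓ0 : ((ℓ : ℕ) : ℚ) ≠ 0 := Nat.cast_ne_zero.2 (Fact.out : ℓ.Prime).ne_zero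
  set r₀ : FramedGaloisRep ℚ ℚ_[ℓ] 4 :=
    (A.rationalTateGaloisRep ℓ (A.continuous_rationalTateRep_holds ℓ hℓ0)).frame b with hr₀def
  have hfr : A.IsFrameOfTateRep ℓ b r₀ := fun g => by
    rw [hr₀def, ContinuousRep.coe_frame_apply]; rfl
  obtain ⟨hunr, hfrob⟩ := hL ℓ hℓ b r₀ hfr v hv
  -- `r g = ((r₀ g⁻¹).val.map φ)ᵀ`
  have hrr₀ : ∀ g, (r g).val = ((r₀ g⁻¹).val.map (algebraMap ℚ_[ℓ] (PadicAlgCl ℓ)))ᵀ := fun g => by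
    rw [hr g, hfr g⁻¹]
  refine ⟨?_, ?_⟩
  · intro 𝔓 h𝔓 τ hτ
    have h1 : r₀ τ⁻¹ = 1 := hunr 𝔓 h𝔓 τ⁻¹ (inv_mem hτ)
    apply Units.ext
    rw [hrr₀ τ, h1, Units.val_one, Matrix.map_one _ (map_zero _) (map_one _), Matrix.transpose_one,
      Units.val_one]
  · intro Q hQ
    obtain ⟨𝔓, h𝔓⟩ := HeightOneSpectrum.primesAbove_nonempty v
    obtain ⟨σ, hσ⟩ := HeightOneSpectrum.exists_isArithFrobAt_of_mem_primesAbove_holds h𝔓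
    have hQσ : FramedRep.charpoly r σ = Q := hQ 𝔓 h𝔓 σ hσ
    have hR : FramedRep.charpoly r₀ σ = L.reverse.map (algebraMap ℚ ℚ_[ℓ]) := hfrob 𝔓 h𝔓 σ hσ
    rw [FramedRep.charpoly] at hQσ hR
    set M : Matrix (Fin 4) (Fin 4) ℚ_[ℓ] := (r₀ σ).val with hMdef
    have hMunit : IsUnit M := ⟨r₀ σ, rfl⟩
    -- `det M = lc L` (constant coefficient of `X⁴L(1/X)`)
    have hdet : M.det = algebraMap ℚ ℚ_[ℓ] L.leadingCoeff := by
      rw [Matrix.det_eq_sign_charpoly_coeff, hR, coeff_map, coeff_zero_reverse, Fintype.card_fin]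
      norm_num
    -- `charpoly M⁻¹ = C (det M)⁻¹ * L`
    have hinv : (M⁻¹).charpoly = C (algebraMap ℚ ℚ_[ℓ] L.leadingCoeff)⁻¹ * L.map (algebraMap ℚ ℚ_[ℓ]) := by
      rw [Matrix.charpoly_inv M hMunit, ← Matrix.reverse_charpoly, hR, Fintype.card_fin,
        reverse_map_of_injective _ (algebraMap ℚ ℚ_[ℓ]).injective,
        Literature.NumberTheory.LFunctions.WeilFatou.reverse_reverse_of_coeff_zero_ne_zero hL0, hdet,
        Ring.inverse_eq_inv']
      norm_num
    -- transport to `r σ = ((r₀ σ⁻¹).map φ)ᵀ = ((M⁻¹).map φ)ᵀ`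
    have hval : (r σ).val = ((M⁻¹).map (algebraMap ℚ_[ℓ] (PadicAlgCl ℓ)))ᵀ := by
      rw [hrr₀ σ, map_inv, Matrix.coe_units_inv]
    rw [← hQσ, hval, Matrix.charpoly_transpose, Matrix.charpoly_map, hinv, Polynomial.map_mul,
      map_C, map_inv₀, Polynomial.map_map, ← IsScalarTower.algebraMap_eq,
      ← IsScalarTower.algebraMap_apply]

/-- **Bridge B3: hypothesis (3b) of BCGP 2025 Thm. 1.1.1 from the Euler factor at `3`.**  If
`L = L_p(A,T)` is the good Euler factor of `A` at `p` (`L(0) ≠ 0`) and `L` is separable over `ℚ` (no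
repeated roots — the cell's DIST0(p) slot, certified by a Bézout pair), then for every prime `ℓ ≠ p`,
every framed dual `r` of `V_ℓ(A)` is unramified at `v ∣ p` and all its Frobenius polynomials there are
separable — VERBATIM the clause (3b) of
`Literature.NumberTheory.DiophantineGeometry.bcgp2025_modThreeSurjective_modular_abelianSurface` at
`p = 3`. [cite: BoxerCalegariGeePilloni2025, Thm. 1.1.1 (3)] [cite: BrumerEtAl2019, (4.1.5) p. 1164] -/
theorem separable_dualFrame_of_hasGoodEulerFactorAt (hL : A.HasGoodEulerFactorAt p L)
    (hL0 : L.coeff 0 ≠ 0) (hsep : L.Separable) :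
    ∀ (ℓ : ℕ) [Fact ℓ.Prime], ℓ ≠ p →
      ∀ (b : Module.Basis (Fin 4) ℚ_[ℓ] (A.rationalTateModule ℓ))
        (r : FramedGaloisRep ℚ (PadicAlgCl ℓ) 4),
        (∀ g : absoluteGaloisGroup ℚ,
          (r g).val =
            ((LinearMap.toMatrix b b (A.rationalTateRep ℓ g⁻¹)).map
              (algebraMap ℚ_[ℓ] (PadicAlgCl ℓ))).transpose) →
        ∀ v : HeightOneSpectrum (𝓞 ℚ), ((p : ℕ) : 𝓞 ℚ) ∈ v.asIdeal →
          r.IsUnramifiedAt v ∧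
            ∀ Q : Polynomial (PadicAlgCl ℓ), r.HasFrobCharpolyAt v Q → Q.Separable := by
  intro ℓ _ hℓ b r hr v hv
  obtain ⟨hunr, hQ⟩ := dualFrame_of_hasGoodEulerFactorAt hL hL0 hℓ b r hr hv
  refine ⟨hunr, fun Q hQv => ?_⟩
  have hlc : L.leadingCoeff ≠ 0 := fun h => hL0 (by rw [leadingCoeff_eq_zero.1 h, coeff_zero])
  rw [hQ Q hQv, mul_comm]
  exact (hsep.map).mul_unit (isUnit_C.2 (IsUnit.inv (IsUnit.mk0 _
    ((map_ne_zero_iff _ (algebraMap ℚ (PadicAlgCl ℓ)).injective).2 hlc))))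

/-- The surface-shaped Euler factor `1 − aT + bT² − qaT³ + q²T⁴` has constant coefficient `1 ≠ 0`
(side condition of the two theorems above). [cite: BrumerEtAl2019, (4.1.5) p. 1164] -/
theorem coeff_zero_lPolynomialOfSurface_map_ne_zero (q : ℕ) (a b : ℤ) :
    ((lPolynomialOfSurface q a b).map (Int.castRingHom ℚ)).coeff 0 ≠ 0 := by
  rw [coeff_map, lPolynomialOfSurface_coeff_zero, map_one]
  exact one_ne_zero

end Summit.Ventures.ResidMod

end
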